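/-
Copyright (c) 2026 the pub-hodgecm-mathlib formalisation cell (harness21).  Prover seat hodgecm-mathlib-K2Liu-p14 (g2), Track B «K2-LIT»,
#184♮ = hLiu418 = `stmt-HodgeConjecture-24832`; socket #42S organ S2 («ARCH SPAN BY K-TYPE PATHS», LEAD F0P6-plan (g14) RULING «M-158f» §4 row S2-W + BATCH #7;
DESIGN-S2 `F0/P6/F0P6-plan-g14/DESIGN-S2-ArchSpanByKTypePaths.F0P6-plan-g14.md` 41bd43fff4457fcc §3 (iii); census K2Liu-p14 (g2) 12:16:02Z (r-a)).
-/
import Summits.HodgeConjecture.HodgeConjecture.Theorems.K2LiuWeilDatumFockStabilityU22     -- ★ (G2-W3 (i)) `κOp_binvPi`, `u22LetterOp_boost_deriv_binvPi`, `u22LetterOp_torus_op_eq`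
import HarnessLib

/-!
# Crux `HLiu418`, organ S2, file S2-W (part 1): EVERY `𝔲(2,2)`-DERIVATIVE OF THE JUNCTION WEIL DATUM PRESERVES POLYNOMIAL × GAUSSIAN —
# `dω X (B⁻¹F) = B⁻¹F_X` for all `X ∈ 𝔲(2,2)` and all Fock polynomials `F` (`𝒫·Gauss_σ` is `D_X`-stable)

Cell `hodgecm-mathlib`, crux item hLiu418 = `stmt-HodgeConjecture-24832`; squad K2 ∕ K2Liu; prover K2Liu-p14 (g2).  THEOREMS ONLY (no `def`, no instance, no
notation, no named-fact hypothesis, no `sorry`); lane `--supports stmt-HodgeConjecture-24832 --as helper`.  Setting: the junction Weil datum of the real dual pair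
`U(2,2) × U(R,S)` on `𝓢(DPIdx (Fin 2) (Fin 2) R S → ℝ, ℂ)` (★ Konno–Konno `isArchWeilDatum_weilRepPair`, vacuum exponents `e`), index-generic `R S` (`(|R|,|S|) = (p′,q′)`).

WHY (DESIGN-S2 §3 (iii)–(iv)).  S2's `Y_σ`-argument needs, on the Weil side, that the Lie derivatives `D_X` (`X ∈ 𝔪 ∪ 𝔫 ∪ {X₋}`, indeed all of `𝔲(2,2)`) PRESERVE
the Fock-finite Schwartz functions `𝒫·Gauss_σ = {B⁻¹F} = {p(x)e^{−π|x|²}}` (★ `binvPi`, ★ `binv_surjective`), with `d∕dt|₀ SW(ω(exp tX)Φ) = SW(D_XΦ)`.  In the junction datum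
the sixteen ADAPTED LETTERS `dωᵢ = preᵢ ∘ genᵢ ∘ postᵢ` (★ `u22AdaptedBasis`, ★ `u22LetterOp`) are: 8 BOOSTS (`𝔭^±`, incl. `𝔫^±`) — ★ `u22LetterOp_boost_deriv_binvPi` gives
`B⁻¹F ↦ B⁻¹F′` EXPLICITLY (degree ±2; no Fourier detour, DESIGN-S2 (k2) moot) — and 8 TORUS letters (`𝔨`), whose generator `torusKGen = (i·vacRate)•id + torusGenPi` is DIAGONAL
on the Hermite basis.  This file closes the torus half and packages the statement for every `X`:
* §1 `torusGenPi_hermitePi` (`torusGenPi v h_β = (i Σ_j v_j β_j) • h_β`), `binvPi_monomial` (`B⁻¹(c z^β) = (c∕hcoef β) • h_β`), `torusGenPi_binvPi_monomial` (eigen-relation),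
  `exists_torusGenPi_binvPi`, `exists_torusKGen_binvPi` (`∃ G, torusKGen e a b (B⁻¹F) = B⁻¹G`);
* §2 `exists_u22LetterOp_torus_deriv_binvPi`, **`exists_u22LetterOp_deriv_binvPi`** (every adapted letter, boost or torus, any frame `k`: `∃ G, preᵢ(genᵢ(postᵢ(B⁻¹F))) = B⁻¹G`),
  **`exists_dOmega_binvPi`** — for every `X ∈ 𝔲(2,2)`: `∃ F_X, Σᵢ aᵢ(X) • dωᵢ(B⁻¹F) = B⁻¹F_X` (`D_X (𝒫·Gauss_σ) ⊆ 𝒫·Gauss_σ`);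
* (part 2, appended on S2-D's head) `exists_hasDerivAt_swArch_expMem_binvPi` — `a := u22AdaptedBasis.repr X` + ★ `hasDerivAt_weilDatum_expMem_smul'` at
  `T := SW_w(·)(g)` ∕ `F_{SW(·)}(u)` (S2-D's section map, a CLM): `∃ F_X, HasDerivAt (t ↦ SW_w(ω (exp (tX), 1) (B⁻¹F))(g)) (SW_w(B⁻¹F_X)(g)) 0` = DESIGN-S2 §3 (iii).
References: [Folland1989, §1.7, §4.2 (4.24), Prop. (4.39)]; [KonnoKonno2007, §3.3, Lemma 5.2]; [KashiwaraVergne1978, §5]; [Varadarajan1984, Thm. 2.10.1].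
HONEST LABEL.  Count-neutral helper: `HC_CM` is proved only modulo the 7 printed citations (2 remaining named inputs: hLiu418 = `stmt-HodgeConjecture-24832`,
h413 = `stmt-HodgeConjecture-24833`) until rung 0 closes.
-/

set_option autoImplicit false
set_option linter.dupNamespace false -- the mandated namespace repeats `HodgeConjecture.HodgeConjecture`

noncomputable section

open scoped MatrixGroups Matrix Topology SchwartzMap ComplexConjugate
open Filter Complex MvPolynomial
open Literature.NumberTheory.Automorphic Literature.Analysis.SegalBargmann Literature.NumberTheory.Weil1964
open Literature.RepresentationTheory.KonnoKonno2007 hiding LetterKind letterOf letterGen letterOf_boost letterOf_torus letterOf_torus_eq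
  letterGen_boost letterGen_torus letterGen_mem_lie exp_smul_letterGen
open Literature.RepresentationTheory.KonnoKonno2007.RealDualPair
open Literature.RepresentationTheory.KonnoKonno2007.RealDualPair.UForm
open Summit.HodgeConjecture.HodgeConjecture.Cruxes.HLiu418.K2LiuU22AdaptedBasis
open Summit.HodgeConjecture.HodgeConjecture.Cruxes.HLiu418.K2LiuWeilDatumSmoothU22

namespace Summit.HodgeConjecture.HodgeConjecture.Cruxes.HLiu418.K2LiuArchWeilFockDerivatives

/-! ## §1 The torus generator is diagonal on polynomial × Gaussian -/

section Torus

variable {σ : Type*} [Fintype σ] [DecidableEq σ]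

/-- **`torusGenPi v h_β = (i Σ_j v_j β_j) • h_β`**: the oscillator-torus generator is diagonal on the Hermite basis (★ `hermiteMultiplierCLM_herm`, transported).
[cite: Folland1989, §1.7] -/
theorem torusGenPi_hermitePi (v : σ → ℝ) (β : σ →₀ ℕ) :
    torusGenPi v (hermitePi β) = (I * torusGenMult v β) • (hermitePi β : SchwartzMap (σ → ℝ) ℂ) := by
  rw [torusGenPi, ContinuousLinearMap.comp_apply, ContinuousLinearMap.comp_apply, hermitePi]
  rw [show ((schwartzTransport (euclE σ)).symm : SchwartzMap (σ → ℝ) ℂ →L[ℂ] 𝓢(EuclideanSpace ℝ σ, ℂ))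
      ((schwartzTransport (euclE σ)) (hermiteSchwartz (herm β))) = hermiteSchwartz (herm β) from
    (schwartzTransport (euclE σ)).symm_apply_apply _]
  rw [hermiteMultiplierCLM_herm, ContinuousLinearEquiv.coe_coe, map_smul]

/-- **`B⁻¹(c z^β) = (c · (hcoef β)⁻¹) • h_β`** (`ζ_β = hcoef β · z^β`, `B⁻¹ζ_β = h_β`). [cite: Folland1989, §1.7] -/
theorem binvPi_monomial (β : σ →₀ ℕ) (c : ℂ) :
    binvPi (monomial β c) = (c * ((hcoef β : ℝ) : ℂ)⁻¹) • (hermitePi β : SchwartzMap (σ → ℝ) ℂ) := by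
  have hh : ((hcoef β : ℝ) : ℂ) ≠ 0 := Complex.ofReal_ne_zero.2 (hcoef_pos β).ne'
  have hmon : monomial β c = (c * ((hcoef β : ℝ) : ℂ)⁻¹) • zeta β := by
    rw [zeta, smul_smul, mul_assoc, inv_mul_cancel₀ hh, mul_one, smul_monomial, smul_eq_mul, mul_one]
  rw [hmon, binvPi_smul, binvPi_zeta]

/-- **eigen-relation on monomial symbols**: `torusGenPi v (B⁻¹(c z^β)) = (i Σ_j v_j β_j) • B⁻¹(c z^β)`. [cite: Folland1989, §1.7] -/
theorem torusGenPi_binvPi_monomial (v : σ → ℝ) (β : σ →₀ ℕ) (c : ℂ) :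
    torusGenPi v (binvPi (monomial β c)) = (I * torusGenMult v β) • (binvPi (monomial β c) : SchwartzMap (σ → ℝ) ℂ) := by
  rw [binvPi_monomial, map_smul, torusGenPi_hermitePi, smul_comm]

/-- **`torusGenPi v` PRESERVES polynomial × Gaussian**: `∃ G, torusGenPi v (B⁻¹F) = B⁻¹G` (`G = Σ_β (i v·β) F_β z^β`). [cite: Folland1989, §1.7] -/
theorem exists_torusGenPi_binvPi (v : σ → ℝ) (F : MvPolynomial σ ℂ) :
    ∃ G : MvPolynomial σ ℂ, torusGenPi v (binvPi F) = (binvPi G : SchwartzMap (σ → ℝ) ℂ) := by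
  induction F using MvPolynomial.induction_on' with
  | monomial β c => exact ⟨(I * torusGenMult v β) • monomial β c, by rw [torusGenPi_binvPi_monomial, binvPi_smul]⟩
  | add p q hp hq =>
    obtain ⟨G₁, h₁⟩ := hp
    obtain ⟨G₂, h₂⟩ := hq
    exact ⟨G₁ + G₂, by rw [binvPi_add, map_add, h₁, h₂, binvPi_add]⟩

end Torus

variable {R S : Type*} [Fintype R] [DecidableEq R] [Fintype S] [DecidableEq S]

/-- **the torus-letter generator preserves polynomial × Gaussian**: `∃ G, torusKGen e a b (B⁻¹F) = B⁻¹G` (`torusKGen = (i·vacRate)•id + torusGenPi`).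
[cite: Folland1989, Prop. (4.39)] -/
theorem exists_torusKGen_binvPi (e : VacExponents) (a b : Fin 2 → ℝ) (F : MvPolynomial (DPIdx (Fin 2) (Fin 2) R S) ℂ) :
    ∃ G : MvPolynomial (DPIdx (Fin 2) (Fin 2) R S) ℂ, torusKGen R S e a b (binvPi F) = binvPi G := by
  obtain ⟨G, hG⟩ := exists_torusGenPi_binvPi (torusIdxWt R S a b) F
  refine ⟨((vacRate e a b : ℂ) * I) • F + G, ?_⟩
  rw [torusKGen, _root_.add_apply, FunLike.coe_smul, Pi.smul_apply, ContinuousLinearMap.id_apply, hG, binvPi_add, binvPi_smul]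

/-! ## §2 Every adapted letter derivative, hence every `dω X`, preserves polynomial × Gaussian -/

/-- **the frame operators preserve polynomial × Gaussian**: `∃ G, κOp e k (B⁻¹F) = B⁻¹G` (★ `κOp_binvPi`, explicit). [cite: Folland1989, Prop. (4.39)] -/
theorem exists_κOp_binvPi (e : VacExponents) (k : DPK (Fin 2) (Fin 2) R S) (F : MvPolynomial (DPIdx (Fin 2) (Fin 2) R S) ℂ) :
    ∃ G : MvPolynomial (DPIdx (Fin 2) (Fin 2) R S) ℂ, κOp R S e k (binvPi F) = binvPi G :=
  ⟨_, κOp_binvPi e k F⟩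

/-- **the TORUS letter derivative preserves polynomial × Gaussian**: `∃ G, κOp (k,1) (torusKGen e a b (κOp (k⁻¹,1) (B⁻¹F))) = B⁻¹G`. [cite: Folland1989, Prop. (4.39)] -/
theorem exists_u22LetterOp_torus_deriv_binvPi (e : VacExponents) (k : Matrix.unitaryGroup (Fin 2) ℂ × Matrix.unitaryGroup (Fin 2) ℂ) (a b : Fin 2 → ℝ)
    (F : MvPolynomial (DPIdx (Fin 2) (Fin 2) R S) ℂ) :
    ∃ G : MvPolynomial (DPIdx (Fin 2) (Fin 2) R S) ℂ,
      (u22LetterOp R S e k (.torus a b)).pre ((u22LetterOp R S e k (.torus a b)).gen ((u22LetterOp R S e k (.torus a b)).post (binvPi F))) = binvPi G := by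
  show ∃ G, κOp R S e (k, 1) (torusKGen R S e a b (κOp R S e (k⁻¹, 1) (binvPi F))) = binvPi G
  obtain ⟨G₁, h₁⟩ := exists_κOp_binvPi e ((k⁻¹, 1) : DPK (Fin 2) (Fin 2) R S) F
  obtain ⟨G₂, h₂⟩ := exists_torusKGen_binvPi (R := R) (S := S) e a b G₁
  obtain ⟨G₃, h₃⟩ := exists_κOp_binvPi e ((k, 1) : DPK (Fin 2) (Fin 2) R S) G₂
  exact ⟨G₃, by rw [h₁, h₂, h₃]⟩

/-- **EVERY ADAPTED LETTER DERIVATIVE PRESERVES POLYNOMIAL × GAUSSIAN** (boost: ★ `u22LetterOp_boost_deriv_binvPi`, explicit; torus: above):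
`∃ G, pre (gen (post (B⁻¹F))) = B⁻¹G`. [cite: Folland1989, Prop. (4.39)] [cite: KashiwaraVergne1978, §5] -/
theorem exists_u22LetterOp_deriv_binvPi (e : VacExponents) (k : Matrix.unitaryGroup (Fin 2) ℂ × Matrix.unitaryGroup (Fin 2) ℂ) (kd : LetterKind)
    (F : MvPolynomial (DPIdx (Fin 2) (Fin 2) R S) ℂ) :
    ∃ G : MvPolynomial (DPIdx (Fin 2) (Fin 2) R S) ℂ,
      (u22LetterOp R S e k kd).pre ((u22LetterOp R S e k kd).gen ((u22LetterOp R S e k kd).post (binvPi F))) = binvPi G := by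
  cases kd with
  | boost p q => exact ⟨_, u22LetterOp_boost_deriv_binvPi e k p q F⟩
  | torus a b => exact exists_u22LetterOp_torus_deriv_binvPi e k a b F

/-- **`D_X (𝒫·Gauss_σ) ⊆ 𝒫·Gauss_σ` FOR EVERY `X ∈ 𝔲(2,2)`**: for every coefficient vector `a : Fin 16 → ℝ` (take `a = u22AdaptedBasis.repr X`) the derivative vector
`dω X (B⁻¹F) := Σᵢ aᵢ • dωᵢ(B⁻¹F)` over the adapted basis is again polynomial × Gaussian: `∃ F_X, Σᵢ aᵢ • preᵢ(genᵢ(postᵢ(B⁻¹F))) = B⁻¹F_X`; with ★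
`hasDerivAt_weilDatum_expMem_smul' hW hvac T (binvPi F) X` this gives `HasDerivAt (t ↦ T (ω (exp (tX), 1) (B⁻¹F))) (T (B⁻¹F_X)) 0` for every continuous ℝ-linear `T`
(one `rw`; the `T := SW_w(·)(g)` instance is part 2). [cite: Folland1989, §4.2 (4.24), Prop. (4.39)] -/
theorem exists_dOmega_binvPi (e : VacExponents) (a : Fin 16 → ℝ) (F : MvPolynomial (DPIdx (Fin 2) (Fin 2) R S) ℂ) :
    ∃ F_X : MvPolynomial (DPIdx (Fin 2) (Fin 2) R S) ℂ,
      (∑ i, ((a i : ℝ) : ℂ) •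
        (u22LetterOp R S e (u22FrameK i) (u22Kind i)).pre
          ((u22LetterOp R S e (u22FrameK i) (u22Kind i)).gen ((u22LetterOp R S e (u22FrameK i) (u22Kind i)).post (binvPi F)))) = binvPi F_X := by
  classical
  choose G hG using fun i : Fin 16 => exists_u22LetterOp_deriv_binvPi (R := R) (S := S) e (u22FrameK i) (u22Kind i) F
  refine ⟨∑ i, ((a i : ℝ) : ℂ) • G i, ?_⟩
  rw [← binvPiₗ_apply (∑ i, _), map_sum]
  refine Finset.sum_congr rfl fun i _ => ?_
  rw [map_smul, binvPiₗ_apply, hG i]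

/-! ## §3 (appended) σ14 — complex coefficients: `D_X` for `X ∈ 𝔤_ℂ` is the ℂ-linear combination of the sixteen letters -/

/-- **`D_X (𝒫·Gauss_σ) ⊆ 𝒫·Gauss_σ` FOR EVERY `X ∈ 𝔤_ℂ`** (LEAD owner word σ14: on the Weil side `D_X := D_{X₁} + i·D_{X₂}` is the ℂ-LINEAR combination of the sixteen real
adapted letters): for every `c : Fin 16 → ℂ`, `∃ F_X, Σᵢ cᵢ • preᵢ(genᵢ(postᵢ(B⁻¹F))) = B⁻¹F_X`. [cite: Folland1989, §4.2 (4.24), Prop. (4.39)] -/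
theorem exists_dOmegaC_binvPi (e : VacExponents) (c : Fin 16 → ℂ) (F : MvPolynomial (DPIdx (Fin 2) (Fin 2) R S) ℂ) :
    ∃ F_X : MvPolynomial (DPIdx (Fin 2) (Fin 2) R S) ℂ,
      (∑ i, c i •
        (u22LetterOp R S e (u22FrameK i) (u22Kind i)).pre
          ((u22LetterOp R S e (u22FrameK i) (u22Kind i)).gen ((u22LetterOp R S e (u22FrameK i) (u22Kind i)).post (binvPi F)))) = binvPi F_X := by
  classical
  choose G hG using fun i : Fin 16 => exists_u22LetterOp_deriv_binvPi (R := R) (S := S) e (u22FrameK i) (u22Kind i) F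
  refine ⟨∑ i, c i • G i, ?_⟩
  rw [← binvPiₗ_apply (∑ i, _), map_sum]
  refine Finset.sum_congr rfl fun i _ => ?_
  rw [map_smul, binvPiₗ_apply, hG i]

/-- the complexified derivative vector `dω X₁ + i·dω X₂` (real coefficient vectors `a₁, a₂ : Fin 16 → ℝ` of `X₁, X₂ ∈ 𝔲(2,2)`) of a polynomial × Gaussian is polynomial ×
Gaussian — σ14's `D_X = D_{X₁} + I•D_{X₂}` literally. [cite: Folland1989, §4.2 (4.24), Prop. (4.39)] -/
theorem exists_dOmega_add_I_smul_dOmega_binvPi (e : VacExponents) (a₁ a₂ : Fin 16 → ℝ) (F : MvPolynomial (DPIdx (Fin 2) (Fin 2) R S) ℂ) :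
    ∃ F_X : MvPolynomial (DPIdx (Fin 2) (Fin 2) R S) ℂ,
      (∑ i, ((a₁ i : ℝ) : ℂ) •
        (u22LetterOp R S e (u22FrameK i) (u22Kind i)).pre
          ((u22LetterOp R S e (u22FrameK i) (u22Kind i)).gen ((u22LetterOp R S e (u22FrameK i) (u22Kind i)).post (binvPi F)))) +
      I • (∑ i, ((a₂ i : ℝ) : ℂ) •
        (u22LetterOp R S e (u22FrameK i) (u22Kind i)).pre
          ((u22LetterOp R S e (u22FrameK i) (u22Kind i)).gen ((u22LetterOp R S e (u22FrameK i) (u22Kind i)).post (binvPi F)))) = binvPi F_X := by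
  obtain ⟨G₁, h₁⟩ := exists_dOmega_binvPi (R := R) (S := S) e a₁ F
  obtain ⟨G₂, h₂⟩ := exists_dOmega_binvPi (R := R) (S := S) e a₂ F
  exact ⟨G₁ + I • G₂, by rw [h₁, h₂, binvPi_add, binvPi_smul]⟩

end Summit.HodgeConjecture.HodgeConjecture.Cruxes.HLiu418.K2LiuArchWeilFockDerivatives

end
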